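import Literature.NumberTheory.EllipticCurves.LambdaAdicSelmerDataSaturatedDivisibility
import Literature.NumberTheory.EllipticCurves.LocalPointsNonsingularReductionDivisibleProofs
import Literature.NumberTheory.EllipticCurves.InertiaInvariantsKodairaNeronAdditiveProofs
import HarnessLib

/-!
# Clause `(S)` for `𝔖_p(K_∞)` at the bad places `v ∤ p`: Kodaira–Néron representatives and divisibility of `E₀(K_v^{nr})`

Topic `NumberTheory/EllipticCurves`; namespaces `WeierstrassCurve` (§1), `WeierstrassCurve.LambdaAdicSelmerData` (§2).
THEOREMS ONLY (no definition, no named fact, no instance, no `sorry`).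

`LambdaAdicSelmerDataSaturatedDivisibility` reduced clause `(S)` of Howard's place-by-place Selmer criterion
(`ZpExtension.EisensteinH1Data.mem_ordinarySelmer_of_local`) for the image of the compact control map
`f = toEisensteinH1Linear : 𝔖_p(K_∞) →ₗ[Λ] H¹(K, T_𝔮)` at a bad place `v ∤ p` to two arithmetic inputs on
`E(K_v^{nr}) = E(K̄_v)^{I_{K_v}}` (`localPoints`, `absInertia`):

  (KN)  finitely many inertia-fixed representatives of `E(K̄_v)^{I}` modulo an inertia-stable subgroup `E₀`;
  (DIV) `E₀ ∩ E(K̄_v)^{I}` is `p`-divisible.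

This file SUPPLIES them (§1, `WeierstrassCurve.exists_kodairaNeron_divisible_localPoints`): `E₀` is Silverman's group of
points with nonsingular reduction on the minimal model at `v` (transported along the `Γ_{K_v}`-equivariant isomorphism
`E(K̄_v) ≃+ V(K̄_v)`, `exists_addEquiv_localPoints_of_smul_eq`; `I_{K_v} = I_𝔐`, `inertia_eq_absInertia`), (KN) is the
tree's PROVED Kodaira–Néron fact over `K_v^{nr}` (`kodairaNeron_exists_finset_reducesToNonsingular_holds`, Silverman *AEC*
Cor. VII.6.2 as applied in the proof of Thm. VII.7.1, *ATAEC* Cor. IV.9.2(d)), and (DIV) is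
`exists_nsmul_eq_of_reducesToNonsingular_of_forall_inertia` (`LocalPointsNonsingularReductionDivisibleProofs`: Hensel over
`K_v^{nr}`, `Ẽ_ns(k̄)` divisible, `[n]` invertible on `E₁`; *AEC* VII.2.1–2.2, VII.3.1, III.2.5). Consequently (§2) clause
`(S)` holds for `h = f s` at every bad `v ∤ p` with NO hypothesis
(`nsmul_localization_proj_toEisensteinH1Linear_mem_unramifiedSubgroup_of_mem_badPlaces`), at every finite `v ∤ p`
(`…_of_not_mem`, exponent `0` at the good places by the `(ur)` clause of `LambdaAdicSelmerDataUnramified`), and in the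
verbatim shape of the hypothesis `hS` of `mem_ordinarySelmer_of_local` for ANY finite set `S` of places
(`toEisensteinH1Linear_hS_of_kodairaNeron`). With `toEisensteinH1Linear_hur` this settles the local conditions of
`f(𝔖) ⊆ H¹_{F_𝔮}(K, T_𝔮)` away from `p` (Howard, *Compos. Math.* 140 (2004), §2.2, Lemma 2.2.7 / Prop. 2.2.8: "the image
of `𝔖` lies in the Selmer group of `F_𝔮`"); the condition at `v ∣ p` (ordinary cores) is not treated here.

References: Silverman, *AEC* (2009), VII.§2 (Props. 2.1, 2.2), Prop. VII.3.1, Thm. VII.6.1 / Cor. VII.6.2, X.§4;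
Silverman, *ATAEC* (1994), Cor. IV.9.2(d); Greenberg, LNM 1716 (1999), §2 (`ℓ ≠ p`); Howard, *Compos. Math.* 140 (2004),
Def. 2.1.1, §2.2; Mazur–Rubin, *Kolyvagin systems* (2004), Lemma 5.3.13. No summit statement is proved here.
-/

noncomputable section

open scoped TensorProduct Topology ContRepresentation Classical NumberField NNReal
open Field CategoryTheory NumberField IsDedekindDomain
open Literature.NumberTheory.GaloisRepresentations Literature.NumberTheory.EllipticCurves
open Literature.NumberTheory.GaloisRepresentations.DiscreteGaloisModule (unramifiedSubgroup)

universe u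

/-! ## §1 (KN) + (DIV) for `E(K̄_v)` in the `localPoints` currency, at a bad place, `n` a unit of `𝓞_v` -/

namespace WeierstrassCurve

open Literature.NumberTheory.EllipticCurves Literature.NumberTheory.GaloisRepresentations Field
  IsDedekindDomain.HeightOneSpectrum

variable {K : Type u} [Field K] [NumberField K] (W : WeierstrassCurve K)

set_option maxHeartbeats 800000 in
/-- **Kodaira–Néron representatives and divisibility of `E₀` over `K_v^{nr}`, for `E(K̄_v) = localPoints`.**
Let `E/K` be an elliptic curve over a number field, `v` a finite place of BAD reduction, `I = absInertia K_v ≤ Γ_{K_v}`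
the inertia group (so `E(K̄_v)^{I} = E(K_v^{nr})`), and `n` a natural number which is a unit of `𝓞_v`. There are a
subgroup `E₀ ≤ E(K̄_v)` (the points whose transport to the minimal model at `v` has nonsingular reduction,
Silverman's `E₀`) and a finite set `T ⊆ E(K̄_v)` such that
(KN) every `I`-fixed `P` has `P - t ∈ E₀`, `I`-fixed, for some `t ∈ T` (Kodaira–Néron: `E(K_v^{nr})/E₀(K_v^{nr})`
is finite, *AEC* Cor. VII.6.2 as applied over `K^{nr}` in the proof of Thm. VII.7.1 — the tree's PROVED
`kodairaNeron_exists_finset_reducesToNonsingular_holds`, whose representatives are `I`-fixed), and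
(DIV) every `I`-fixed `X ∈ E₀` is `n • Y` for an `I`-fixed `Y ∈ E₀`
(`exists_nsmul_eq_of_reducesToNonsingular_of_forall_inertia`: Hensel over `K_v^{nr}`, `Ẽ_ns(k̄)` divisible, `[n]`
invertible on `E₁`). These are exactly the hypotheses `hT`, `hdiv` of
`localPoints_exists_pow_nsmul_of_kodairaNeron_of_divisible` / `LambdaAdicSelmerData.hdiv_of_kodairaNeron_of_divisible`
(`LambdaAdicSelmerDataSaturatedDivisibility`). Transport `E(K̄_v) ≃+ V(K̄_v)` to the minimal model by
`exists_addEquiv_localPoints_of_smul_eq` (equivariant), `I = I_𝔐` by `inertia_eq_absInertia`.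
[cite: SilvermanAEC2009, Thm. VII.6.1, Cor. VII.6.2 (over `K^{nr}`, proof of Thm. VII.7.1), Props. VII.2.1–2.2, VII.3.1]
[cite: GreenbergLNM1716, §2 (Prop. 2.1, `ℓ ≠ p`)] -/
theorem exists_kodairaNeron_divisible_localPoints [W.IsElliptic] {v : HeightOneSpectrum (𝓞 K)}
    (hv : v ∈ W.badPlaces (𝓞 K)) {n : ℕ} (hn : IsUnit ((n : ℕ) : v.adicCompletionIntegers K)) :
    ∃ (E₀ : AddSubgroup (localPoints W (v.adicCompletion K))) (T : Finset (localPoints W (v.adicCompletion K))),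
      (∀ P : localPoints W (v.adicCompletion K), (∀ σ ∈ absInertia (v.adicCompletion K), σ • P = P) →
        ∃ t ∈ T, (∀ σ ∈ absInertia (v.adicCompletion K), σ • (P - t) = P - t) ∧ P - t ∈ E₀) ∧
      (∀ X ∈ E₀, (∀ σ ∈ absInertia (v.adicCompletion K), σ • X = X) →
        ∃ Y ∈ E₀, (∀ σ ∈ absInertia (v.adicCompletion K), σ • Y = Y) ∧ n • Y = X) := by
  have hbad : ¬ W.HasGoodReductionAt v := hv
  obtain ⟨w, hw⟩ := v.exists_spectralValuation
  obtain ⟨𝔐, h𝔐⟩ := v.localPrimesAbove_nonempty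
  have hvw : w.Integers w.integer := Valuation.integer.integers w
  have hI : ∀ σ : absoluteGaloisGroup (v.adicCompletion K),
      σ ∈ absInertia (v.adicCompletion K) ↔ σ ∈ 𝔐.inertia (absoluteGaloisGroup (v.adicCompletion K)) := fun σ ↦ by
    rw [HeightOneSpectrum.inertia_eq_absInertia hw h𝔐]
  haveI := isIntegral_spectralValuation_baseChange hw (W.localMinimalIntegralModel v)
  haveI := W.isElliptic_map_localMinimalIntegralModel (v := v)
  haveI := W.isMinimal_map_localMinimalIntegralModel (v := v)
  -- the equivariant transport `Φ : E(K̄_v) ≃+ V(K̄_v)` to the minimal model `V = (M ⊗ K_v) ⊗ K̄_v`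
  obtain ⟨C, hC⟩ := W.exists_variableChange_eq_localMinimalIntegralModel v
  obtain ⟨Φ, hΦ⟩ := W.exists_addEquiv_localPoints_of_smul_eq v hC
  have hfixΦ : ∀ P : localPoints W (v.adicCompletion K), (∀ σ ∈ absInertia (v.adicCompletion K), σ • P = P) ↔
      ∀ τ ∈ 𝔐.inertia (absoluteGaloisGroup (v.adicCompletion K)), Affine.Point.map ((absoluteGaloisGroup.toAlgEquiv (v.adicCompletion K) τ : AlgebraicClosure (v.adicCompletion K) ≃ₐ[v.adicCompletion K] AlgebraicClosure (v.adicCompletion K)) : AlgebraicClosure (v.adicCompletion K) →ₐ[v.adicCompletion K] AlgebraicClosure (v.adicCompletion K)) (Φ P) = Φ P := by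
    intro P
    constructor
    · intro h τ hτ
      rw [← hΦ, h τ ((hI τ).mpr hτ)]
    · intro h σ hσ
      apply Φ.injective
      rw [hΦ]
      exact h σ ((hI σ).mp hσ)
  -- `E₀ ≤ V(K̄_v)` as a subgroup, through an `𝒪_w`-model `W₀` with `V = W₀ ⊗ K̄_v`
  have hint : (((W.localMinimalIntegralModel v).map (algebraMap (v.adicCompletionIntegers K) (v.adicCompletion K))).baseChange (AlgebraicClosure (v.adicCompletion K))).IsIntegral w.integer := inferInstance
  obtain ⟨W₀, hW₀⟩ := hint.integral
  let E₀V : AddSubgroup (((W.localMinimalIntegralModel v).map (algebraMap (v.adicCompletionIntegers K) (v.adicCompletion K))).baseChange (AlgebraicClosure (v.adicCompletion K))).toAffine.Point :=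
    (W₀.nonsingularReductionSubgroup hvw).comap (Affine.Point.congrEquiv hW₀).toAddMonoidHom
  have hmemE₀V : ∀ P, P ∈ E₀V ↔ ReducesToNonsingular w (IsLocalRing.residue w.integer) P := by
    intro P
    change W₀.HasNonsingularReduction (Affine.Point.congrEquiv hW₀ P) ↔ _
    rw [← reducesToNonsingular_iff_hasNonsingularReduction W₀, WeierstrassCurve.reducesToNonsingular_congrEquiv_iff w _ hW₀ P]
  let E₀ : AddSubgroup (localPoints W (v.adicCompletion K)) := E₀V.comap Φ.toAddMonoidHom
  have hmemE₀ : ∀ P, P ∈ E₀ ↔ ReducesToNonsingular w (IsLocalRing.residue w.integer) (Φ P) := fun P ↦ hmemE₀V (Φ P)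
  -- (KN) on the minimal model: the PROVED Kodaira–Néron fact over `K_v^{nr}`
  obtain ⟨T, hTfix, hT⟩ := (kodairaNeron_exists_finset_reducesToNonsingular_holds
    (X := (W.localMinimalIntegralModel v).map (algebraMap (v.adicCompletionIntegers K) (v.adicCompletion K)))) w hw h𝔐
  refine ⟨E₀, T.image Φ.symm, fun P hP ↦ ?_, fun X hX hXI ↦ ?_⟩
  · obtain ⟨t, ht, hPt⟩ := hT (Φ P) ((hfixΦ P).mp hP)
    have htfix : ∀ σ ∈ absInertia (v.adicCompletion K), σ • Φ.symm t = Φ.symm t :=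
      (hfixΦ (Φ.symm t)).mpr fun τ hτ ↦ by rw [Φ.apply_symm_apply]; exact hTfix t ht τ hτ
    refine ⟨Φ.symm t, Finset.mem_image_of_mem _ ht, fun σ hσ ↦ by rw [smul_sub, hP σ hσ, htfix σ hσ], ?_⟩
    rw [hmemE₀, map_sub, Φ.apply_symm_apply]
    exact hPt
  · obtain ⟨Q, hQE₀, hQI, hQ⟩ := W.exists_nsmul_eq_of_reducesToNonsingular_of_forall_inertia hw h𝔐 hbad hn
      ((hmemE₀ X).mp hX) ((hfixΦ X).mp hXI)
    refine ⟨Φ.symm Q, ?_, (hfixΦ _).mpr fun τ hτ ↦ by rw [Φ.apply_symm_apply]; exact hQI τ hτ, ?_⟩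
    · rw [hmemE₀, Φ.apply_symm_apply]
      exact hQE₀
    · apply Φ.injective
      rw [map_nsmul, Φ.apply_symm_apply, hQ]

/-- **The same for a prime-to-`v` natural number given globally** (`(n : 𝓞 K) ∉ v`, the form in which `v ∤ p` is
carried by the Selmer files). [cite: SilvermanAEC2009, Cor. VII.6.2, Props. VII.2.1–2.2, VII.3.1] -/
theorem exists_kodairaNeron_divisible_localPoints_of_not_mem [W.IsElliptic] {v : HeightOneSpectrum (𝓞 K)}
    (hv : v ∈ W.badPlaces (𝓞 K)) {n : ℕ} (hn : ((n : ℕ) : 𝓞 K) ∉ v.asIdeal) :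
    ∃ (E₀ : AddSubgroup (localPoints W (v.adicCompletion K))) (T : Finset (localPoints W (v.adicCompletion K))),
      (∀ P : localPoints W (v.adicCompletion K), (∀ σ ∈ absInertia (v.adicCompletion K), σ • P = P) →
        ∃ t ∈ T, (∀ σ ∈ absInertia (v.adicCompletion K), σ • (P - t) = P - t) ∧ P - t ∈ E₀) ∧
      (∀ X ∈ E₀, (∀ σ ∈ absInertia (v.adicCompletion K), σ • X = X) →
        ∃ Y ∈ E₀, (∀ σ ∈ absInertia (v.adicCompletion K), σ • Y = Y) ∧ n • Y = X) := by
  refine W.exists_kodairaNeron_divisible_localPoints hv ?_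
  have h := isUnit_algebraMap_adicCompletionIntegers K v hn
  rwa [map_natCast] at h

end WeierstrassCurve

/-! ## §2 Clause `(S)` of Howard's Selmer criterion for the image of `𝔖_p(K_∞)`, unconditionally -/

namespace WeierstrassCurve.LambdaAdicSelmerData

open Literature.NumberTheory.EllipticCurves Literature.NumberTheory.GaloisRepresentations Field
  Literature.NumberTheory.GaloisRepresentations.DiscreteGaloisModule

variable {K : Type u} [Field K] [NumberField K] {V : WeierstrassCurve K} [V.IsElliptic] {p : ℕ} [hp : Fact p.Prime]
  {κ : ZpExtension K p} {γ : absoluteGaloisGroup K} (D : V.LambdaAdicSelmerData κ γ) {m : ℕ} (hm : 1 ≤ m)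

section Linear

variable (t : ∀ k, (V.torsionGaloisModule ((p : ℤ) ^ (k + 1))).toContRepresentation →ⁱL
    (V.torsionGaloisModule ((p : ℤ) ^ k)).toContRepresentation)
  (ht : ∀ k (P : geomTorsion V ((p : ℤ) ^ (k + 1))), t k P = V.geomTorsionReduce p k P)
  (I : ZpExtension.EisensteinH1Data (κ.unitTwist (-1)) (fun k ↦ V.torsionGaloisModule ((p : ℤ) ^ k)) t hm)

include ht

/-- **Clause `(S)` at a BAD place `v ∤ p` for `h = f s`, unconditionally.** For the compact control map
`f = toEisensteinH1Linear : 𝔖_p(K_∞) →ₗ[Λ] H¹(K, T_𝔮)` and a finite place `v ∤ p` of bad reduction there is an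
exponent `a` (namely `v_p((#T)!)` for the Kodaira–Néron representatives `T`) with
`p^a • loc_v (proj k (f s)) ∈ H¹_{ur}(K_v, T_𝔮/p^k)` for every `k`: the reduction
`nsmul_localization_proj_toEisensteinH1Linear_mem_unramifiedSubgroup_of_kodairaNeron_of_divisible`
(`LambdaAdicSelmerDataSaturatedDivisibility`) fed with (KN) + (DIV) (`exists_kodairaNeron_divisible_localPoints_of_not_mem`).
[cite: Howard2004HeegnerKolyvagin, Def. 2.1.1, §2.2 Lemma 2.2.7 and Prop. 2.2.8]
[cite: SilvermanAEC2009, Thm. VII.6.1, Cor. VII.6.2, Props. VII.2.1–2.2, X.§4 proof of Thm. 4.2(b)] [cite: GreenbergLNM1716, §2] -/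
theorem nsmul_localization_proj_toEisensteinH1Linear_mem_unramifiedSubgroup_of_mem_badPlaces
    (hγ : κ.IsTopGenerator γ) (hE : ∀ P : V.toAffine.Point, p • P = 0 → P = 0) (s : D.S)
    {v : HeightOneSpectrum (𝓞 K)} (hv : v ∈ V.badPlaces (𝓞 K)) (hpv : ((p : ℕ) : 𝓞 K) ∉ v.asIdeal) :
    ∃ a : ℕ, ∀ k,
      p ^ a • galoisCohomology.localization
          ((κ.unitTwist (-1)).eisensteinTwist (V.torsionGaloisModule ((p : ℤ) ^ k)) hm k) (Sum.inr v) 1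
          (I.proj k (D.toEisensteinH1Linear hm t ht I hγ hE s)) ∈
        unramifiedSubgroup
          (GaloisRep.toLocal v ((κ.unitTwist (-1)).eisensteinTwist (V.torsionGaloisModule ((p : ℤ) ^ k)) hm k)) 1 := by
  obtain ⟨E₀, T, hT, hdiv⟩ := V.exists_kodairaNeron_divisible_localPoints_of_not_mem hv hpv
  exact D.nsmul_localization_proj_toEisensteinH1Linear_mem_unramifiedSubgroup_of_kodairaNeron_of_divisible hm t ht I
    hγ hE s hpv E₀ T hT hdiv

/-- **Clause `(S)` at EVERY finite place `v ∤ p` for `h = f s`**: `∃ a, ∀ k, p^a • loc_v (proj k (f s)) ∈ H¹_{ur}(K_v, T_𝔮/p^k)`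
— at a good place with `a = 0` (`localization_proj_toEisensteinH1Linear_mem_unramifiedSubgroup`, the `(ur)` clause,
Silverman X.4.4), at a bad place by Kodaira–Néron and the divisibility of `E₀(K_v^{nr})`
(`…_of_mem_badPlaces`). [cite: Howard2004HeegnerKolyvagin, §2.1, Def. 2.1.1, Lemma 2.2.7 and Prop. 2.2.8]
[cite: SilvermanAEC2009, Cor. X.4.4, Cor. VII.6.2] -/
theorem nsmul_localization_proj_toEisensteinH1Linear_mem_unramifiedSubgroup_of_not_mem
    (hγ : κ.IsTopGenerator γ) (hE : ∀ P : V.toAffine.Point, p • P = 0 → P = 0) (s : D.S)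
    {v : HeightOneSpectrum (𝓞 K)} (hpv : ((p : ℕ) : 𝓞 K) ∉ v.asIdeal) :
    ∃ a : ℕ, ∀ k,
      p ^ a • galoisCohomology.localization
          ((κ.unitTwist (-1)).eisensteinTwist (V.torsionGaloisModule ((p : ℤ) ^ k)) hm k) (Sum.inr v) 1
          (I.proj k (D.toEisensteinH1Linear hm t ht I hγ hE s)) ∈
        unramifiedSubgroup
          (GaloisRep.toLocal v ((κ.unitTwist (-1)).eisensteinTwist (V.torsionGaloisModule ((p : ℤ) ^ k)) hm k)) 1 := by
  by_cases hv : v ∈ V.badPlaces (𝓞 K)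
  · exact D.nsmul_localization_proj_toEisensteinH1Linear_mem_unramifiedSubgroup_of_mem_badPlaces hm t ht I hγ hE s hv hpv
  · exact ⟨0, fun k ↦ by
      rw [pow_zero, one_smul]
      exact D.localization_proj_toEisensteinH1Linear_mem_unramifiedSubgroup hm t ht I hγ hE s k hv hpv⟩

/-- **The hypothesis `hS` of `ZpExtension.EisensteinH1Data.mem_ordinarySelmer_of_local` for the image of `𝔖_p(K_∞)`,
for ANY finite set `S` of places, unconditionally**: `∀ v ∈ S, v ∤ p → ∃ a, ∀ k, p^a • loc_v (proj k (f s)) ∈ H¹_{ur}`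
(compare `toEisensteinH1Linear_hS`, `LambdaAdicSelmerDataSaturatedTransport`, which took `(S-loc)_a` as a hypothesis).
Together with `toEisensteinH1Linear_hur` (`LambdaAdicSelmerDataUnramified`) this discharges the two clauses AWAY FROM `p`
of the place-by-place Selmer criterion for `f(𝔖)`; the clause at `v ∣ p` (the ordinary cores) is not treated here.
[cite: Howard2004HeegnerKolyvagin, Def. 2.1.1, §2.2 Lemma 2.2.7 and Prop. 2.2.8] [cite: MazurRubinMemoirs2004, Lemma 5.3.13] -/
theorem toEisensteinH1Linear_hS_of_kodairaNeron (hγ : κ.IsTopGenerator γ)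
    (hE : ∀ P : V.toAffine.Point, p • P = 0 → P = 0) (S : Finset (HeightOneSpectrum (𝓞 K))) (s : D.S) :
    ∀ v ∈ S, ((p : ℕ) : 𝓞 K) ∉ v.asIdeal → ∃ a : ℕ, ∀ k,
      p ^ a • galoisCohomology.localization
          ((κ.unitTwist (-1)).eisensteinTwist (V.torsionGaloisModule ((p : ℤ) ^ k)) hm k) (Sum.inr v) 1
          (I.proj k (D.toEisensteinH1Linear hm t ht I hγ hE s)) ∈
        unramifiedSubgroup
          (GaloisRep.toLocal v ((κ.unitTwist (-1)).eisensteinTwist (V.torsionGaloisModule ((p : ℤ) ^ k)) hm k)) 1 :=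
  fun _ _ hpv ↦ D.nsmul_localization_proj_toEisensteinH1Linear_mem_unramifiedSubgroup_of_not_mem hm t ht I hγ hE s hpv

end Linear

end WeierstrassCurve.LambdaAdicSelmerData

end
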